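import Summits.QuantumFields.YangMills.Theorems.UnitScaleTiltProp7TrueLinReality
import Summits.QuantumFields.YangMills.Theorems.UnitScaleTiltProp7EMLTowerCentral
import HarnessLib

/-!
# Route `UnitScaleTilt`, crux K1 child «MinimiserStabilityRegPr» (stmt-QuantumFields-19200), stub `stub_existenceMinimalOrbit` (EX), lane II (B4★)∕(QB) «⊕ central» summand —
# **THE TRUE LINEARISATION `T_V` OF THE (0.4) AVERAGE ON THE CENTRE `ℂ·1` IS THE FLAT SCALAR LINEAR AVERAGE** (the second half of px19 g6's LOCATE v2 §3 (c-i): «the central identity for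
# `Q^{E′}` from `hQs` — eml is homogeneous under central scalings»; the central twin of ★routeR-w2's ✓`Prop7TrueLinReality.su_trueLin`): for the `hQs` one-step letter of record
# `T_V(Y)(c) = D eml(W)[i ↦ Y_V(loop_i)·W_i]·κ* + κ·Y_V([y,y′])·κ*` (`W_i = loopHol V c i`, `κ = corr ℰ V c`) and a CENTRAL fine field `Y = s·1`:
# **`T_V(s·1)(c) = (|I|⁻¹ Σ_i s(loop_i) + s([y,y′]))·1`** — a scalar that does NOT see the background `V` — whenever the loop variables `W_i` are within `1∕8` of `1` (and on the
# `SU(N)` guard `δ_N`); hence along any two background towers with small loops the `hQs` recursion families AGREE on central fields and stay central (§4).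

Cell `ym3-torus`, width seat `ym3-torus-px10` (gen 5).  `--supports stmt-QuantumFields-19200 --as helper`; THEOREMS ONLY (0 `def`, 0 `sorry`); count-neutral; nothing here claims the
stub, the crux, d = 4 or the mass gap — YM₃ on T³ is a ladder rung (R3), not the Clay problem.

MECHANISM.  (i) Every `Ad`-transport fixes the centre, so the covariant signed sum of `s·1` is the plain signed sum: `Y_V(Γ) = s(Γ)·1` (§1).  (ii) The direction fed to `D eml(W)` is then
`i ↦ σ_i·W_i`, a CENTRAL RESCALING of the loop family; `eml` is homogeneous under central rescalings (✓`Prop7SymAvgTwSym.eml_algebraMap_mul`: `eml(ι(z_i)·W_i) = ι(eml z)·eml W`), so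
along the complex curve `z ↦ (e^{zσ_i}·W_i)_i` one has `eml = e^{z·mean σ}·eml(W)` near `z = 0`, and differentiating: **`D eml(W)[σ·W]·eml(W)* = (mean σ)·1`** (§2; `eml W ∈ SU(N)` by
(0.9)).  (iii) `κ = eml W` on the guard (✓`coe_corr_eq_eml`) and `κ·(w·1)·κ* = w·1`.

WHAT IS PROVED (any `SU(n)`, `Fintype n`, any `P : Params`):
* §1 `conj_smul_one_stepFactor`, ★`covWalkSum_smul_one` (`covWalkSum V (s·1) Γ = (walkSum s Γ)·1`).
* §2 ★★`fderiv_eml_centralDir_mul_star` (`D eml(W)[i ↦ σ_i·W_i]·(eml W)* = (|ι|⁻¹Σσ_i)·1` for `W_i ∈ SU(N)`, `‖W_i − 1‖ ≤ 1∕8`, `‖W_i − 1‖ < δ_N`).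
* §3 ★★`trueLin_smul_one` (the `hQs` one-step letter VERBATIM at a background `V` applied to `s·1` equals `(|I|⁻¹Σ_i walkSum s (loop walk i) + walkSum s (straight walk))·1`).
* §4 ★★★`trueLinIter_smul_one_eq` — for two `hQs`-families `Q`, `Q′` along the towers of `U₀`, `U₀′` (the `hQB` letters of ✓`Prop7EngOfTrueAvgBudget.hEng_of_trueAvgBudget` VERBATIM) whose loop
  variables are `1∕8`-small and on the guard at every level `j < k`: `Q k (c·1) = Q′ k (c·1)` and `Q k (c·1) e ∈ ℂ·1` — in particular (at `U₀′ := 1`) THE CURVED FAMILY EQUALS THE FLAT FAMILY ON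
  THE CENTRE.  `eighth_lt_deltaSU_two` records `1∕8 < δ₂` for the `SU(2)` member.
HONEST SCOPE.  Linear algebra and one derivative over the cited tree theorems; the loop windows are DISPLAYED (at a printed-regular background they follow from ✓`plaqSmall_iter_T3_allL` + Stokes as
in ✓`loopHolU_emlIterU_bgUnits_le_eighth_of_regPr`); nothing of (QB)∕(ENG)∕(REC)∕`hN06`∕the crux is advanced by this file alone; nothing of print is asserted.

References: T. Bałaban, CMP **99** (1985) 389–434 [Balaban1985BackgroundPropagators] ((3.13)–(3.15) p.393); CMP **95** (1984) 17–40 [Balaban1984PropagatorsI] ((1.18)–(1.20) pp.19–20);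
CMP **98** (1985) 17–51 [Balaban1985Averaging] ((58) p.27, Prop. 3 (122)–(125) p.36); CMP **109** (1987) 249–301 [Balaban1987RG1] ((0.4)–(0.9) p.253).
-/

set_option autoImplicit false

noncomputable section

open scoped BigOperators Matrix.Norms.L2Operator Topology
open Filter NormedSpace Metric Set

namespace Summit.QuantumFields.YangMills.Theorems.Prop7TrueLinCentral

open Literature.MathematicalPhysics.QuantumFieldTheory.Balaban1983to89
open Finset T4Continuum BlockAveraging AveragingRT ExpMeanLog BlockAveragingEMLLinearised BlockAveragingEMLLinearisedBackground BlockAveragingEMLProp2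
open MatrixLog (mlog mlog_one)
open B7BlockAvgLog (mlog_exp)
open Summit.QuantumFields.YangMills.Theorems.Prop7HolRatioPerStep (coe_star_mul_self coe_mul_star_self stepFactor_mul_star' star_mul_stepFactor')
open Summit.QuantumFields.YangMills.Theorems.Prop7TrueLinPureGauge (coe_corr_eq_eml)
open Summit.QuantumFields.YangMills.Theorems.Prop7TrueLinReality (guard_facts)
open Summit.QuantumFields.YangMills.Theorems.Prop7SymAvgTwSym (eml_algebraMap_mul commute_algebraMap)

variable {n : Type*} [Fintype n] [DecidableEq n] [Nonempty n]

/-! ## §1 Covariant signed sums of central fields are plain signed sums -/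

section Sums

variable {P : Params} {j : ℕ}

omit [Nonempty n] in
/-- unitary conjugation fixes the centre: `g·(a·1)·g* = a·1`. [cite: Balaban1985Averaging, (56) p.27] -/
theorem conj_smul_one_stepFactor (V : GaugeField P j (Matrix.specialUnitaryGroup n ℂ)) (s : LStep P j) (a : ℂ) :
    stepFactor V s * (a • (1 : Matrix n n ℂ)) * star (stepFactor V s) = a • (1 : Matrix n n ℂ) := by
  rw [mul_smul_comm, mul_one, smul_mul_assoc, stepFactor_mul_star']

omit [Nonempty n] in
/-- ★ **`Y_V(Γ) = s(Γ)·1` FOR A CENTRAL FIELD `Y = s·1`**: every background transport fixes the centre, so the covariant signed sum (58) is the plain signed sum of the scalars.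
[cite: Balaban1985Averaging, (58) p.27; Balaban1984PropagatorsI, (1.8) p.19] -/
theorem covWalkSum_smul_one (V : GaugeField P j (Matrix.specialUnitaryGroup n ℂ)) (s : PBond P j → ℂ) :
    ∀ γ : List (LStep P j), covWalkSum V (fun b => s b • (1 : Matrix n n ℂ)) γ = (walkSum s γ) • (1 : Matrix n n ℂ)
  | [] => by rw [covWalkSum_nil, walkSum_nil, zero_smul]
  | st :: γ => by
    rw [covWalkSum_cons, walkSum_cons, covWalkSum_smul_one V s γ, conj_smul_one_stepFactor, add_smul]
    congr 1
    unfold covStep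
    split_ifs with h
    · rfl
    · rw [conj_smul_one_stepFactor, neg_smul]

end Sums

/-! ## §2 The derivative of `eml` along a central rescaling of the loop family -/

section Eml

/-- ★★ **`D eml(W)[i ↦ σ_i·W_i]·eml(W)* = (|ι|⁻¹ Σ_i σ_i)·1`** for `W_i ∈ SU(N)` within `1∕8` of `1` and on the guard `δ_N`: along `z ↦ (e^{zσ_i}W_i)_i` the average is `e^{z·mean σ}·eml W`
near `0` (✓`eml_algebraMap_mul` — eml is homogeneous under central rescalings —, `log e^{zσ_i} = zσ_i` below `ln 2`), `eml W ∈ SU(N)` ((0.9) ✓`eml_mem_specialUnitaryGroup`), and the chain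
rule at `z = 0` (✓`differentiableAt_eml`). [cite: Balaban1987RG1, (0.4)-(0.9) p.253; Balaban1985BackgroundPropagators, (3.13)-(3.14) p.393] -/
theorem fderiv_eml_centralDir_mul_star {ι : Type*} [Fintype ι] [Nonempty ι] (W : ι → Matrix n n ℂ) (hW : ∀ i, W i ∈ Matrix.specialUnitaryGroup n ℂ)
    (h8 : ∀ i, ‖W i - 1‖ ≤ 1 / 8) (hδ : ∀ i, ‖W i - 1‖ < deltaSU n) (σ : ι → ℂ) :
    fderiv ℂ (eml : (ι → Matrix n n ℂ) → Matrix n n ℂ) W (fun i => σ i • W i) * star (eml W)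
      = (((Fintype.card ι : ℂ))⁻¹ * ∑ i, σ i) • (1 : Matrix n n ℂ) := by
  letI : NormedAlgebra ℚ (Matrix n n ℂ) := NormedAlgebra.restrictScalars ℚ ℂ _
  set m : ℂ := ((Fintype.card ι : ℂ))⁻¹ * ∑ i, σ i with hm
  set E₀ : Matrix n n ℂ := eml W with hE₀
  -- `eml W ∈ SU(N)`, so `E₀ E₀* = 1`
  have hE₀SU : E₀ ∈ Matrix.specialUnitaryGroup n ℂ :=
    eml_mem_specialUnitaryGroup hW (fun i => (guard_facts (hδ i)).1) (fun i => (guard_facts (hδ i)).2)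
  have hE₀U : E₀ * star E₀ = 1 := Matrix.mem_unitaryGroup_iff.1 (Matrix.mem_specialUnitaryGroup_iff.1 hE₀SU).1
  -- the complex curve `γ(z) = (e^{zσ_i}·W_i)_i` and its derivative at `0`
  set γ : ℂ → (ι → Matrix n n ℂ) := fun z i => Complex.exp (z * σ i) • W i with hγ
  have hγ0 : γ 0 = W := by
    funext i; simp only [hγ, zero_mul, Complex.exp_zero, one_smul]
  have hγd : HasDerivAt γ (fun i => σ i • W i) 0 := by
    refine hasDerivAt_pi.2 fun i => ?_
    have h1 : HasDerivAt (fun z : ℂ => Complex.exp (z * σ i)) (σ i) 0 := by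
      have h := ((hasDerivAt_id' (0 : ℂ)).mul_const (σ i)).cexp
      rw [zero_mul, Complex.exp_zero, one_mul, one_mul] at h
      exact h
    exact h1.smul_const (W i)
  -- chain rule through `eml`, then right translation by `E₀*`
  have hW1' : ∀ i, ‖W i - 1‖ < 1 := fun i => (h8 i).trans_lt (by norm_num)
  have heml : HasFDerivAt (eml : (ι → Matrix n n ℂ) → Matrix n n ℂ) (fderiv ℂ (eml : (ι → Matrix n n ℂ) → Matrix n n ℂ) W) W :=
    (differentiableAt_eml hW1').hasFDerivAt
  have hP : HasDerivAt (fun z : ℂ => eml (γ z) * star E₀)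
      (fderiv ℂ (eml : (ι → Matrix n n ℂ) → Matrix n n ℂ) W (fun i => σ i • W i) * star E₀) 0 :=
    (heml.comp_hasDerivAt_of_eq (0 : ℂ) hγd hγ0.symm).mul_const _
  -- near `0` the curve is the explicit scalar curve `e^{zm}·1`
  have hlog2 := Real.log_two_gt_d9
  have hev₁ : ∀ᶠ z : ℂ in 𝓝 0, ∀ i, ‖Complex.exp (z * σ i) - 1‖ ≤ 1 / 8 := by
    refine Filter.eventually_all.2 fun i => ?_
    have hc : ContinuousAt (fun z : ℂ => Complex.exp (z * σ i)) 0 := (Complex.continuous_exp.comp (continuous_id.mul continuous_const)).continuousAt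
    have hopen : IsOpen {w : ℂ | ‖w - 1‖ < 1 / 8} := isOpen_lt (continuous_id.sub continuous_const).norm continuous_const
    have hmem : Complex.exp (0 * σ i) ∈ {w : ℂ | ‖w - 1‖ < 1 / 8} := by
      show ‖Complex.exp (0 * σ i) - 1‖ < 1 / 8
      rw [zero_mul, Complex.exp_zero, sub_self, norm_zero]; norm_num
    filter_upwards [hc.preimage_mem_nhds (hopen.mem_nhds hmem)] with z hz
    exact le_of_lt hz
  have hev₂ : ∀ᶠ z : ℂ in 𝓝 0, ∀ i, ‖z * σ i‖ < Real.log 2 := by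
    refine Filter.eventually_all.2 fun i => ?_
    have hc : ContinuousAt (fun z : ℂ => z * σ i) 0 := (continuous_id.mul continuous_const).continuousAt
    have hopen : IsOpen {w : ℂ | ‖w‖ < Real.log 2} := isOpen_lt continuous_norm continuous_const
    have hmem : (0 : ℂ) * σ i ∈ {w : ℂ | ‖w‖ < Real.log 2} := by
      show ‖(0 : ℂ) * σ i‖ < Real.log 2
      rw [zero_mul, norm_zero]; linarith
    filter_upwards [hc.preimage_mem_nhds (hopen.mem_nhds hmem)] with z hz
    exact hz
  have hev : (fun z : ℂ => Complex.exp (z * m) • (1 : Matrix n n ℂ)) =ᶠ[𝓝 (0 : ℂ)] fun z : ℂ => eml (γ z) * star E₀ := by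
    filter_upwards [hev₁, hev₂] with z hz1 hz2
    -- `eml (e^{zσ}·W) = ι(eml e^{zσ}) · eml W`
    have hfam : γ z = fun i => algebraMap ℂ (Matrix n n ℂ) (Complex.exp (z * σ i)) * W i := by
      funext i; rw [hγ]; dsimp only; rw [Algebra.algebraMap_eq_smul_one, smul_mul_assoc, one_mul]
    have hsplit : eml (γ z) = algebraMap ℂ (Matrix n n ℂ) (eml fun i => Complex.exp (z * σ i)) * eml W := by
      rw [hfam]; exact eml_algebraMap_mul hz1 h8
    -- `eml (e^{zσ_i}) = e^{z·m}` at `𝔸 = ℂ`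
    have hscal : (eml fun i => Complex.exp (z * σ i)) = Complex.exp (z * m) := by
      rw [Complex.exp_eq_exp_ℂ, eml_eq_exp, smul_eq_mul]
      congr 1
      have hsum : ∑ i, mlog (NormedSpace.exp (z * σ i)) = ∑ i, z * σ i :=
        Finset.sum_congr rfl fun i _ => mlog_exp (hz2 i)
      rw [hsum, ← Finset.mul_sum, hm]
      ring
    rw [hsplit, hscal, Algebra.algebraMap_eq_smul_one, smul_mul_assoc, one_mul, smul_mul_assoc, ← hE₀, hE₀U]
  -- the scalar curve has derivative `m·1` at `0`
  have hg : HasDerivAt (fun z : ℂ => Complex.exp (z * m) • (1 : Matrix n n ℂ)) (m • (1 : Matrix n n ℂ)) 0 := by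
    have h1 : HasDerivAt (fun z : ℂ => Complex.exp (z * m)) m 0 := by
      have h := ((hasDerivAt_id' (0 : ℂ)).mul_const m).cexp
      rw [zero_mul, Complex.exp_zero, one_mul, one_mul] at h
      exact h
    exact h1.smul_const (1 : Matrix n n ℂ)
  exact (hP.unique (hg.congr_of_eventuallyEq hev.symm)).trans rfl

/-- for the `SU(2)` member: `1∕8 < δ₂ = min(1∕3, π∕2)`. [folklore] -/
theorem eighth_lt_deltaSU_two : (1 : ℝ) / 8 < deltaSU (Fin 2) := by
  unfold deltaSU
  rw [Fintype.card_fin]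
  have hπ := Real.pi_gt_three
  refine lt_min (by norm_num) ?_
  push_cast
  linarith

end Eml

/-! ## §3 The true one-step operator on the centre -/

section OneStep

variable {P : Params} {j : ℕ}

/-- ★★ **`T_V(s·1)(c) = (|I|⁻¹Σ_i s(loop_i) + s([y,y′]))·1` — THE TRUE LINEARISATION OF THE (0.4) AVERAGE DOES NOT SEE THE BACKGROUND ON CENTRAL FIELDS** (the `hQs` one-step letter of
record at a background `V` whose loop variables at `c` are within `1∕8` of `1` and on the guard `δ_N`): §1 for the covariant sums, §2 for the `D eml` term with `κ = eml W`
(✓`coe_corr_eq_eml`), `κ·(w·1)·κ* = w·1` for the straight term. [cite: Balaban1985BackgroundPropagators, (3.13)-(3.14) p.393; Balaban1984PropagatorsI, (1.18)-(1.20) pp.19-20; Balaban1987RG1, (0.4) p.253] -/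
theorem trueLin_smul_one (V : GaugeField P j (Matrix.specialUnitaryGroup n ℂ)) (s : PBond P j → ℂ) (c : PBond P (j + 1))
    (h8 : ∀ i : Idx P, ‖((loopHol V c i : Matrix.specialUnitaryGroup n ℂ) : Matrix n n ℂ) - 1‖ ≤ 1 / 8) (hδ : ∀ i : Idx P, dist1 (loopHol V c i) < deltaSU n) :
    fderiv ℂ (eml : (Idx P → Matrix n n ℂ) → Matrix n n ℂ)
          (fun i => ((loopHol V c i : Matrix.specialUnitaryGroup n ℂ) : Matrix n n ℂ))
          (fun i => covWalkSum V (fun b => s b • (1 : Matrix n n ℂ)) (walk (emb c.src) (loopWord P.L c.dir (off i.1) i.2.1 i.2.2))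
            * ((loopHol V c i : Matrix.specialUnitaryGroup n ℂ) : Matrix n n ℂ))
          * star ((corr (expMeanLogSU (n := n)) V c : Matrix.specialUnitaryGroup n ℂ) : Matrix n n ℂ)
        + ((corr (expMeanLogSU (n := n)) V c : Matrix.specialUnitaryGroup n ℂ) : Matrix n n ℂ)
          * covWalkSum V (fun b => s b • (1 : Matrix n n ℂ)) (walk (emb c.src) (List.replicate P.L (c.dir, true)))
          * star ((corr (expMeanLogSU (n := n)) V c : Matrix.specialUnitaryGroup n ℂ) : Matrix n n ℂ)
      = ((((Fintype.card (Idx P) : ℂ))⁻¹ * ∑ i : Idx P, walkSum s (walk (emb c.src) (loopWord P.L c.dir (off i.1) i.2.1 i.2.2)))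
          + walkSum s (walk (emb c.src) (List.replicate P.L (c.dir, true)))) • (1 : Matrix n n ℂ) := by
  have hκ := coe_corr_eq_eml V c hδ
  have hW1 : ∀ i : Idx P, ‖((loopHol V c i : Matrix.specialUnitaryGroup n ℂ) : Matrix n n ℂ) - 1‖ < deltaSU n := fun i => by
    rw [← FederbushMean.dist1_SU_eq]; exact hδ i
  -- the directions are central rescalings of the loops
  have hdir : (fun i : Idx P => covWalkSum V (fun b => s b • (1 : Matrix n n ℂ)) (walk (emb c.src) (loopWord P.L c.dir (off i.1) i.2.1 i.2.2))
        * ((loopHol V c i : Matrix.specialUnitaryGroup n ℂ) : Matrix n n ℂ))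
      = fun i : Idx P => (walkSum s (walk (emb c.src) (loopWord P.L c.dir (off i.1) i.2.1 i.2.2))) • ((loopHol V c i : Matrix.specialUnitaryGroup n ℂ) : Matrix n n ℂ) := by
    funext i
    rw [covWalkSum_smul_one, smul_mul_assoc, one_mul]
  rw [hdir, hκ, fderiv_eml_centralDir_mul_star _ (fun i => (loopHol V c i).prop) h8 hW1, covWalkSum_smul_one, ← hκ, mul_smul_comm, mul_one, smul_mul_assoc,
    coe_mul_star_self, add_smul]

end OneStep

/-! ## §4 The recursion families along two towers agree on the centre -/

section Families

variable {P : Params}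

/-- ★★★ **THE `hQs`-FAMILIES OF TWO BACKGROUND TOWERS AGREE ON CENTRAL FIELDS AND STAY CENTRAL**: for `Q` along `Ū₀^{(·)}` and `Q′` along `Ū₀′^{(·)}` (both the `hQB` letters VERBATIM) with
`1∕8`-small loop variables on the guard at every level `j < k`, `Q k (c·1) = Q′ k (c·1)` and `Q k (c·1) e ∈ ℂ·1` — induction on `k` over §3 (the scalar one-step does not read the background).
At `U₀′ := 1` (trivial loops) this is «the curved true-linearised family equals the flat one on the centre». [cite: Balaban1984PropagatorsI, (1.18)-(1.20) pp.19-20; Balaban1985BackgroundPropagators, (3.14)-(3.15) p.393] -/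
theorem trueLinIter_smul_one_eq (U₀ U₀' : GaugeField P 0 (Matrix.specialUnitaryGroup n ℂ))
    (Q Q' : (k : ℕ) → (PBond P 0 → Matrix n n ℂ) → PBond P k → Matrix n n ℂ)
    (hQ0 : ∀ Y, Q 0 Y = Y)
    (hQs : ∀ (k : ℕ) (Y : PBond P 0 → Matrix n n ℂ) (c : PBond P (k + 1)), Q (k + 1) Y c
      = fderiv ℂ (eml : (Idx P → Matrix n n ℂ) → Matrix n n ℂ)
            (fun i => ((loopHol (Averaging.iter (fun i => blockAvg (P := P) (j := i) (expMeanLogSU (n := n))) k U₀) c i : Matrix.specialUnitaryGroup n ℂ) : Matrix n n ℂ))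
            (fun i => covWalkSum (Averaging.iter (fun i => blockAvg (P := P) (j := i) (expMeanLogSU (n := n))) k U₀) (Q k Y) (walk (emb c.src) (loopWord P.L c.dir (off i.1) i.2.1 i.2.2))
              * ((loopHol (Averaging.iter (fun i => blockAvg (P := P) (j := i) (expMeanLogSU (n := n))) k U₀) c i : Matrix.specialUnitaryGroup n ℂ) : Matrix n n ℂ))
            * star ((corr (expMeanLogSU (n := n)) (Averaging.iter (fun i => blockAvg (P := P) (j := i) (expMeanLogSU (n := n))) k U₀) c : Matrix.specialUnitaryGroup n ℂ) : Matrix n n ℂ)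
          + ((corr (expMeanLogSU (n := n)) (Averaging.iter (fun i => blockAvg (P := P) (j := i) (expMeanLogSU (n := n))) k U₀) c : Matrix.specialUnitaryGroup n ℂ) : Matrix n n ℂ)
            * covWalkSum (Averaging.iter (fun i => blockAvg (P := P) (j := i) (expMeanLogSU (n := n))) k U₀) (Q k Y) (walk (emb c.src) (List.replicate P.L (c.dir, true)))
            * star ((corr (expMeanLogSU (n := n)) (Averaging.iter (fun i => blockAvg (P := P) (j := i) (expMeanLogSU (n := n))) k U₀) c : Matrix.specialUnitaryGroup n ℂ) : Matrix n n ℂ))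
    (hQ0' : ∀ Y, Q' 0 Y = Y)
    (hQs' : ∀ (k : ℕ) (Y : PBond P 0 → Matrix n n ℂ) (c : PBond P (k + 1)), Q' (k + 1) Y c
      = fderiv ℂ (eml : (Idx P → Matrix n n ℂ) → Matrix n n ℂ)
            (fun i => ((loopHol (Averaging.iter (fun i => blockAvg (P := P) (j := i) (expMeanLogSU (n := n))) k U₀') c i : Matrix.specialUnitaryGroup n ℂ) : Matrix n n ℂ))
            (fun i => covWalkSum (Averaging.iter (fun i => blockAvg (P := P) (j := i) (expMeanLogSU (n := n))) k U₀') (Q' k Y) (walk (emb c.src) (loopWord P.L c.dir (off i.1) i.2.1 i.2.2))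
              * ((loopHol (Averaging.iter (fun i => blockAvg (P := P) (j := i) (expMeanLogSU (n := n))) k U₀') c i : Matrix.specialUnitaryGroup n ℂ) : Matrix n n ℂ))
            * star ((corr (expMeanLogSU (n := n)) (Averaging.iter (fun i => blockAvg (P := P) (j := i) (expMeanLogSU (n := n))) k U₀') c : Matrix.specialUnitaryGroup n ℂ) : Matrix n n ℂ)
          + ((corr (expMeanLogSU (n := n)) (Averaging.iter (fun i => blockAvg (P := P) (j := i) (expMeanLogSU (n := n))) k U₀') c : Matrix.specialUnitaryGroup n ℂ) : Matrix n n ℂ)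
            * covWalkSum (Averaging.iter (fun i => blockAvg (P := P) (j := i) (expMeanLogSU (n := n))) k U₀') (Q' k Y) (walk (emb c.src) (List.replicate P.L (c.dir, true)))
            * star ((corr (expMeanLogSU (n := n)) (Averaging.iter (fun i => blockAvg (P := P) (j := i) (expMeanLogSU (n := n))) k U₀') c : Matrix.specialUnitaryGroup n ℂ) : Matrix n n ℂ)) :
    ∀ k : ℕ,
      (∀ j, j < k → ∀ (c : PBond P (j + 1)) (i : Idx P),
        ‖((loopHol (Averaging.iter (fun i => blockAvg (P := P) (j := i) (expMeanLogSU (n := n))) j U₀) c i : Matrix.specialUnitaryGroup n ℂ) : Matrix n n ℂ) - 1‖ ≤ 1 / 8 ∧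
          dist1 (loopHol (Averaging.iter (fun i => blockAvg (P := P) (j := i) (expMeanLogSU (n := n))) j U₀) c i) < deltaSU n) →
      (∀ j, j < k → ∀ (c : PBond P (j + 1)) (i : Idx P),
        ‖((loopHol (Averaging.iter (fun i => blockAvg (P := P) (j := i) (expMeanLogSU (n := n))) j U₀') c i : Matrix.specialUnitaryGroup n ℂ) : Matrix n n ℂ) - 1‖ ≤ 1 / 8 ∧
          dist1 (loopHol (Averaging.iter (fun i => blockAvg (P := P) (j := i) (expMeanLogSU (n := n))) j U₀') c i) < deltaSU n) →
      ∀ c : PBond P 0 → ℂ, ∃ s : PBond P k → ℂ,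
        Q k (fun b => c b • (1 : Matrix n n ℂ)) = (fun e => s e • (1 : Matrix n n ℂ)) ∧ Q' k (fun b => c b • (1 : Matrix n n ℂ)) = (fun e => s e • (1 : Matrix n n ℂ))
  | 0 => fun _ _ c => ⟨c, hQ0 _, hQ0' _⟩
  | k + 1 => fun hU hU' c => by
    obtain ⟨s, hs, hs'⟩ := trueLinIter_smul_one_eq U₀ U₀' Q Q' hQ0 hQs hQ0' hQs' k (fun j hj => hU j (by omega)) (fun j hj => hU' j (by omega)) c
    refine ⟨fun e => (((Fintype.card (Idx P) : ℂ))⁻¹ * ∑ i : Idx P, walkSum s (walk (emb e.src) (loopWord P.L e.dir (off i.1) i.2.1 i.2.2)))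
      + walkSum s (walk (emb e.src) (List.replicate P.L (e.dir, true))), ?_, ?_⟩
    · funext e
      rw [hQs, hs]
      exact trueLin_smul_one _ s e (fun i => (hU k (by omega) e i).1) (fun i => (hU k (by omega) e i).2)
    · funext e
      rw [hQs', hs']
      exact trueLin_smul_one _ s e (fun i => (hU' k (by omega) e i).1) (fun i => (hU' k (by omega) e i).2)

/-- **COROLLARY**: under the same windows, `Q k (c·1) = Q′ k (c·1)`. [cite: Balaban1984PropagatorsI, (1.18)-(1.20) pp.19-20] -/
theorem trueLinIter_smul_one_eq' (U₀ U₀' : GaugeField P 0 (Matrix.specialUnitaryGroup n ℂ))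
    (Q Q' : (k : ℕ) → (PBond P 0 → Matrix n n ℂ) → PBond P k → Matrix n n ℂ)
    (hQ0 : ∀ Y, Q 0 Y = Y)
    (hQs : ∀ (k : ℕ) (Y : PBond P 0 → Matrix n n ℂ) (c : PBond P (k + 1)), Q (k + 1) Y c
      = fderiv ℂ (eml : (Idx P → Matrix n n ℂ) → Matrix n n ℂ)
            (fun i => ((loopHol (Averaging.iter (fun i => blockAvg (P := P) (j := i) (expMeanLogSU (n := n))) k U₀) c i : Matrix.specialUnitaryGroup n ℂ) : Matrix n n ℂ))
            (fun i => covWalkSum (Averaging.iter (fun i => blockAvg (P := P) (j := i) (expMeanLogSU (n := n))) k U₀) (Q k Y) (walk (emb c.src) (loopWord P.L c.dir (off i.1) i.2.1 i.2.2))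
              * ((loopHol (Averaging.iter (fun i => blockAvg (P := P) (j := i) (expMeanLogSU (n := n))) k U₀) c i : Matrix.specialUnitaryGroup n ℂ) : Matrix n n ℂ))
            * star ((corr (expMeanLogSU (n := n)) (Averaging.iter (fun i => blockAvg (P := P) (j := i) (expMeanLogSU (n := n))) k U₀) c : Matrix.specialUnitaryGroup n ℂ) : Matrix n n ℂ)
          + ((corr (expMeanLogSU (n := n)) (Averaging.iter (fun i => blockAvg (P := P) (j := i) (expMeanLogSU (n := n))) k U₀) c : Matrix.specialUnitaryGroup n ℂ) : Matrix n n ℂ)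
            * covWalkSum (Averaging.iter (fun i => blockAvg (P := P) (j := i) (expMeanLogSU (n := n))) k U₀) (Q k Y) (walk (emb c.src) (List.replicate P.L (c.dir, true)))
            * star ((corr (expMeanLogSU (n := n)) (Averaging.iter (fun i => blockAvg (P := P) (j := i) (expMeanLogSU (n := n))) k U₀) c : Matrix.specialUnitaryGroup n ℂ) : Matrix n n ℂ))
    (hQ0' : ∀ Y, Q' 0 Y = Y)
    (hQs' : ∀ (k : ℕ) (Y : PBond P 0 → Matrix n n ℂ) (c : PBond P (k + 1)), Q' (k + 1) Y c
      = fderiv ℂ (eml : (Idx P → Matrix n n ℂ) → Matrix n n ℂ)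
            (fun i => ((loopHol (Averaging.iter (fun i => blockAvg (P := P) (j := i) (expMeanLogSU (n := n))) k U₀') c i : Matrix.specialUnitaryGroup n ℂ) : Matrix n n ℂ))
            (fun i => covWalkSum (Averaging.iter (fun i => blockAvg (P := P) (j := i) (expMeanLogSU (n := n))) k U₀') (Q' k Y) (walk (emb c.src) (loopWord P.L c.dir (off i.1) i.2.1 i.2.2))
              * ((loopHol (Averaging.iter (fun i => blockAvg (P := P) (j := i) (expMeanLogSU (n := n))) k U₀') c i : Matrix.specialUnitaryGroup n ℂ) : Matrix n n ℂ))
            * star ((corr (expMeanLogSU (n := n)) (Averaging.iter (fun i => blockAvg (P := P) (j := i) (expMeanLogSU (n := n))) k U₀') c : Matrix.specialUnitaryGroup n ℂ) : Matrix n n ℂ)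
          + ((corr (expMeanLogSU (n := n)) (Averaging.iter (fun i => blockAvg (P := P) (j := i) (expMeanLogSU (n := n))) k U₀') c : Matrix.specialUnitaryGroup n ℂ) : Matrix n n ℂ)
            * covWalkSum (Averaging.iter (fun i => blockAvg (P := P) (j := i) (expMeanLogSU (n := n))) k U₀') (Q' k Y) (walk (emb c.src) (List.replicate P.L (c.dir, true)))
            * star ((corr (expMeanLogSU (n := n)) (Averaging.iter (fun i => blockAvg (P := P) (j := i) (expMeanLogSU (n := n))) k U₀') c : Matrix.specialUnitaryGroup n ℂ) : Matrix n n ℂ))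
    (k : ℕ)
    (hU : ∀ j, j < k → ∀ (c : PBond P (j + 1)) (i : Idx P),
      ‖((loopHol (Averaging.iter (fun i => blockAvg (P := P) (j := i) (expMeanLogSU (n := n))) j U₀) c i : Matrix.specialUnitaryGroup n ℂ) : Matrix n n ℂ) - 1‖ ≤ 1 / 8 ∧
        dist1 (loopHol (Averaging.iter (fun i => blockAvg (P := P) (j := i) (expMeanLogSU (n := n))) j U₀) c i) < deltaSU n)
    (hU' : ∀ j, j < k → ∀ (c : PBond P (j + 1)) (i : Idx P),
      ‖((loopHol (Averaging.iter (fun i => blockAvg (P := P) (j := i) (expMeanLogSU (n := n))) j U₀') c i : Matrix.specialUnitaryGroup n ℂ) : Matrix n n ℂ) - 1‖ ≤ 1 / 8 ∧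
        dist1 (loopHol (Averaging.iter (fun i => blockAvg (P := P) (j := i) (expMeanLogSU (n := n))) j U₀') c i) < deltaSU n)
    (c : PBond P 0 → ℂ) :
    Q k (fun b => c b • (1 : Matrix n n ℂ)) = Q' k (fun b => c b • (1 : Matrix n n ℂ)) ∧
      ∀ e : PBond P k, ∃ s : ℂ, Q k (fun b => c b • (1 : Matrix n n ℂ)) e = s • (1 : Matrix n n ℂ) := by
  obtain ⟨s, hs, hs'⟩ := trueLinIter_smul_one_eq U₀ U₀' Q Q' hQ0 hQs hQ0' hQs' k hU hU' c
  exact ⟨hs.trans hs'.symm, fun e => ⟨s e, by rw [hs]⟩⟩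

end Families

end Summit.QuantumFields.YangMills.Theorems.Prop7TrueLinCentral

end
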